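import Summits.Ventures.LatticeQCDFlow.Exactness.IMHCommonRandomNumbers
import HarnessLib

/-!
# Common random numbers, the exact top row: from a pair containing the mode the CRN pair kernel IS
# `A·(π on the diagonal) + (1 − A)·(frozen mode ⊗ residual move)` — merging probability EXACTLY `A`

HONEST FRAMING: exact (Metropolis-corrected) sampling algorithms for lattice gauge theory;
figures of merit are autocorrelation/cost numbers at stated couplings and volumes; no
continuum-physics claim.

Venture `LatticeQCDFlow` (cell pub-lqcd), topic `Exactness`; FANOUT row 30 (lean-1, GEN-36).  NEW WORK of the
cell, general state space.  Sequel of `Exactness/IMHCommonRandomNumbers` (this generation), which built the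
common-random-numbers pair kernel `K̂` of `K = indepMH q w` (`w` maximal at `x₀`, `A = 1/w(x₀)`) and proved the
diagonal MINORISATION `K̂(z, ·) ≥ A·π∘diag⁻¹` for every pair; its module docstring announces the present theorem
`crnPair_top_apply`, which is proved HERE (the file-size limit splits it off):

* **`volume_section_crnPairUpdate_top`** — the `u`-section of the top pair's update at a fixed proposal `y`:
  `U{u : Ψ_{(x₀,x′)}(y, u) ∈ C} = 1_D(y)·a(x₀, y) + 1_B(y)·(a(x′, y) − a(x₀, y)) + 1_B(x′)·(1 − a(x′, y))`
  (`D = {y : (y, y) ∈ C}`, `B = {y′ : (x₀, y′) ∈ C}`): the three `u`-regimes «both accept» ⊆ «the lighter run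
  accepts» and «both reject»;
* **`crnPair_top_apply`** — THE EXACT TOP ROW: for `w(x₀) > 1` and every `x′`,
  `K̂((x₀, x′), ·) = A·π∘(y ↦ (y, y))⁻¹ + (1 − A)·R(x′, ·)∘(y′ ↦ (x₀, y′))⁻¹` with `R` the residual kernel of the
  exact minorisation (`Exactness/IMHAnyStartSplit`, Literature `DoeblinMinorization`): EITHER both runs merge onto
  one fresh `π`-draw — probability EXACTLY `A`, the minorisation of the previous file is an equality on top pairs —
  OR the modal run stays frozen while the other moves by the residual kernel (GEN-34's `R(x₀, ·) = δ_{x₀}` is the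
  first coordinate of this row).
Reading (gauge files): from (cold, anything) one shared update of the exact gauge samplers merges the two runs with
probability exactly `A = Z/(c^{#B}M^k)` resp. `Z/∏_ℓ c_{#C_ℓ}`.
NOT CLAIMED: a closed form for non-top rows (only the bound `≥ A·π∘diag⁻¹`).  No `sorry`, no new definitions,
nothing cited as a fact.
-/

noncomputable section

namespace Summit.Ventures.LatticeQCDFlow.Exactness

open MeasureTheory ProbabilityTheory Function Set
open scoped ENNReal unitInterval
open Literature.Probability.MarkovChains

variable {Ω : Type*} [MeasurableSpace Ω] {q : Measure Ω} [IsProbabilityMeasure q] {w : Ω → ℝ}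

/-! ## The exact top row -/

omit [MeasurableSpace Ω] in
/-- The `u`-section of the top pair's update at a fixed proposal `y`: with `D = {y : (y, y) ∈ C}`,
`B = {y′ : (x₀, y′) ∈ C}`, `a₀ = a(x₀, ·)`, `a′ = a(x′, ·)`:
`U{u : Ψ_{(x₀,x′)}(y, u) ∈ C} = 1_D(y)·a₀(y) + 1_B(y)·(a′(y) − a₀(y)) + 1_B(x′)·(1 − a′(y))`. [ours] -/
theorem volume_section_crnPairUpdate_top (hw0 : ∀ y, 0 < w y) {x₀ : Ω} (hmax : ∀ y, w y ≤ w x₀) (x' y : Ω)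
    (C : Set (Ω × Ω)) :
    (volume : Measure unitInterval) {u : unitInterval |
        ((if (u : ℝ) * w x₀ ≤ w y then y else x₀), (if (u : ℝ) * w x' ≤ w y then y else x')) ∈ C} =
      {y : Ω | (y, y) ∈ C}.indicator (imhAcceptE w x₀) y +
        ({y' : Ω | (x₀, y') ∈ C}.indicator (fun y' => imhAcceptE w x' y' - imhAcceptE w x₀ y') y +
          {y' : Ω | (x₀, y') ∈ C}.indicator 1 x' * (1 - imhAcceptE w x' y)) := by
  -- the three `u`-regimes: `T1` (both accept) ⊆ `T3ᶜ` (the second accepts); `T3` (both reject)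
  set T1 : Set unitInterval := {u | (u : ℝ) * w x₀ ≤ w y} with hT1
  set T2 : Set unitInterval := {u | (u : ℝ) * w x' ≤ w y} with hT2
  set S : Set unitInterval := {u : unitInterval |
        ((if (u : ℝ) * w x₀ ≤ w y then y else x₀), (if (u : ℝ) * w x' ≤ w y then y else x')) ∈ C} with hS
  have hm1 : MeasurableSet T1 := measurableSet_le (measurable_subtype_coe.mul_const _) measurable_const
  have hm2 : MeasurableSet T2 := measurableSet_le (measurable_subtype_coe.mul_const _) measurable_const
  have h12 : T1 ⊆ T2 := fun u hu => (mul_le_mul_of_nonneg_left (hmax x') u.2.1).trans hu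
  have hvol1 : (volume : Measure unitInterval) T1 = imhAcceptE w x₀ y := volume_unitInterval_accept hw0 x₀ y
  have hvol2 : (volume : Measure unitInterval) T2 = imhAcceptE w x' y := volume_unitInterval_accept hw0 x' y
  have hvol3 : (volume : Measure unitInterval) T2ᶜ = 1 - imhAcceptE w x' y := by
    rw [prob_compl_eq_one_sub hm2, hvol2]
  have hvol21 : (volume : Measure unitInterval) (T2 \ T1) = imhAcceptE w x' y - imhAcceptE w x₀ y := by
    rw [measure_sdiff h12 hm1.nullMeasurableSet (measure_ne_top _ _), hvol1, hvol2]
  -- the partition `S = (S ∩ T1) ∪ (S ∩ (T2 \ T1)) ∪ (S ∩ T2ᶜ)`, piece by piece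
  have hsplit : (volume : Measure unitInterval) S =
      (volume : Measure unitInterval) (S ∩ T2 ∩ T1) + (volume : Measure unitInterval) ((S ∩ T2) \ T1) +
        (volume : Measure unitInterval) (S \ T2) := by
    rw [measure_inter_add_sdiff _ hm1, measure_inter_add_sdiff _ hm2]
  have hp1 : (volume : Measure unitInterval) (S ∩ T2 ∩ T1) = {y : Ω | (y, y) ∈ C}.indicator (imhAcceptE w x₀) y := by
    have hset : S ∩ T2 ∩ T1 = {u ∈ T1 | (y, y) ∈ C} := by
      ext u
      simp only [Set.mem_inter_iff, Set.mem_setOf_eq, hS, hT1, hT2]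
      constructor
      · rintro ⟨⟨hu, h2⟩, h1⟩
        rw [if_pos h1, if_pos h2] at hu
        exact ⟨h1, hu⟩
      · rintro ⟨h1, hc⟩
        refine ⟨⟨?_, h12 h1⟩, h1⟩
        have h2 : (u : ℝ) * w x' ≤ w y := h12 h1
        rw [if_pos h1, if_pos h2]; exact hc
    by_cases hc : (y, y) ∈ C
    · have hc' : y ∈ {y : Ω | (y, y) ∈ C} := hc
      rw [hset, Set.indicator_of_mem hc', ← hvol1]
      congr 1; ext u; simp [hc]
    · have hc' : y ∉ {y : Ω | (y, y) ∈ C} := hc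
      rw [hset, Set.indicator_of_notMem hc']
      have : {u ∈ T1 | (y, y) ∈ C} = ∅ := by ext u; simp [hc]
      rw [this, measure_empty]
  have hp2 : (volume : Measure unitInterval) ((S ∩ T2) \ T1) =
      {y' : Ω | (x₀, y') ∈ C}.indicator (fun y' => imhAcceptE w x' y' - imhAcceptE w x₀ y') y := by
    have hset : (S ∩ T2) \ T1 = {u ∈ T2 \ T1 | (x₀, y) ∈ C} := by
      ext u
      simp only [Set.mem_inter_iff, Set.mem_sdiff, Set.mem_setOf_eq, hS, hT1, hT2]
      constructor
      · rintro ⟨⟨hu, h2⟩, h1⟩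
        rw [if_neg h1, if_pos h2] at hu
        exact ⟨⟨h2, h1⟩, hu⟩
      · rintro ⟨⟨h2, h1⟩, hc⟩
        refine ⟨⟨?_, h2⟩, h1⟩
        rw [if_neg h1, if_pos h2]; exact hc
    by_cases hc : (x₀, y) ∈ C
    · have hc' : y ∈ {y' : Ω | (x₀, y') ∈ C} := hc
      rw [hset, Set.indicator_of_mem hc', ← hvol21]
      congr 1; ext u; simp [hc]
    · have hc' : y ∉ {y' : Ω | (x₀, y') ∈ C} := hc
      rw [hset, Set.indicator_of_notMem hc']
      have : {u ∈ T2 \ T1 | (x₀, y) ∈ C} = ∅ := by ext u; simp [hc]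
      rw [this, measure_empty]
  have hp3 : (volume : Measure unitInterval) (S \ T2) =
      {y' : Ω | (x₀, y') ∈ C}.indicator 1 x' * (1 - imhAcceptE w x' y) := by
    have hset : S \ T2 = {u ∈ T2ᶜ | (x₀, x') ∈ C} := by
      ext u
      simp only [Set.mem_sdiff, Set.mem_compl_iff, Set.mem_setOf_eq, hS, hT2]
      constructor
      · rintro ⟨hu, h2⟩
        have h1 : ¬ ((u : ℝ) * w x₀ ≤ w y) := fun h1 => h2 (h12 h1)
        rw [if_neg h1, if_neg h2] at hu
        exact ⟨h2, hu⟩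
      · rintro ⟨h2, hc⟩
        have h1 : ¬ ((u : ℝ) * w x₀ ≤ w y) := fun h1 => h2 (h12 h1)
        refine ⟨?_, h2⟩
        rw [if_neg h1, if_neg h2]; exact hc
    by_cases hc : (x₀, x') ∈ C
    · have hc' : x' ∈ {y' : Ω | (x₀, y') ∈ C} := hc
      rw [hset, Set.indicator_of_mem hc', Pi.one_apply, one_mul, ← hvol3]
      congr 1; ext u; simp [hc]
    · have hc' : x' ∉ {y' : Ω | (x₀, y') ∈ C} := hc
      rw [hset, Set.indicator_of_notMem hc', zero_mul]
      have : {u ∈ T2ᶜ | (x₀, x') ∈ C} = ∅ := by ext u; simp [hc]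
      rw [this, measure_empty]
  rw [hsplit, hp1, hp2, hp3, add_assoc]

/-- **THE EXACT TOP ROW.**  `w` measurable (a `Fact`), positive, normalised, maximal at `x₀` with `w(x₀) > 1`; `R` the
residual kernel of the exact minorisation (`Exactness/IMHAnyStartSplit`).  From a pair containing the mode:
`K̂((x₀, x′), ·) = A·π∘(y ↦ (y, y))⁻¹ + (1 − A)·(R(x′, ·)∘(y′ ↦ (x₀, y′))⁻¹)` — either both runs merge onto one fresh
target draw (probability EXACTLY `A`), or the modal run stays frozen while the other moves by the residual kernel.
[ours] -/
theorem crnPair_top_apply [Fact (Measurable w)] (hw0 : ∀ y, 0 < w y) {x₀ : Ω} (hmax : ∀ y, w y ≤ w x₀)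
    (hlt : 1 < w x₀) [IsProbabilityMeasure (q.withDensity fun y => ENNReal.ofReal (w y))]
    (Khat : Kernel (Ω × Ω) (Ω × Ω))
    (hK : ∀ z : Ω × Ω, Khat z = (q.prod (volume : Measure unitInterval)).map (fun p : Ω × unitInterval =>
      ((if (p.2 : ℝ) * w z.1 ≤ w p.1 then p.1 else z.1), (if (p.2 : ℝ) * w z.2 ≤ w p.1 then p.1 else z.2))))
    (x' : Ω) :
    Khat (x₀, x') =
      ENNReal.ofReal (w x₀)⁻¹ • (q.withDensity fun y => ENNReal.ofReal (w y)).map (fun y : Ω => (y, y)) +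
        ENNReal.ofReal (1 - (w x₀)⁻¹) •
          ((Doeblin.residualKernel (indepMH q w) (q.withDensity fun y => ENNReal.ofReal (w y))
              (ENNReal.ofReal (w x₀)⁻¹) (indepMH_minorised_mode Fact.out hw0 hmax)) x').map (Prod.mk x₀) := by
  have hw : Measurable w := Fact.out
  set π : Measure Ω := q.withDensity fun y => ENNReal.ofReal (w y) with hπ
  set ε : ℝ≥0∞ := ENNReal.ofReal (w x₀)⁻¹ with hε
  have hε1 : ε < 1 := ofReal_inv_lt_one_of_one_lt hlt
  have h1e : 1 - ε ≠ 0 := (tsub_pos_of_lt hε1).ne'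
  have h1t : 1 - ε ≠ ⊤ := ne_top_of_le_ne_top ENNReal.one_ne_top tsub_le_self
  set R := Doeblin.residualKernel (indepMH q w) π ε (indepMH_minorised_mode Fact.out hw0 hmax) with hR
  have hdiag : Measurable (fun y : Ω => (y, y)) := measurable_id.prodMk measurable_id
  have ha0m : Measurable (imhAcceptE w x₀) := (measurable_imhAcceptE hw).comp measurable_prodMk_left
  have haxm : Measurable (imhAcceptE w x') := (measurable_imhAcceptE hw).comp measurable_prodMk_left
  -- `a₀ ≤ a′` pointwise and `a₀ = ε·w`
  have ha0_le : ∀ y, imhAcceptE w x₀ y ≤ imhAcceptE w x' y := by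
    intro y
    rw [imhAcceptE_mode_eq hw0 hmax y, ← hε, hε, ← ENNReal.ofReal_mul (inv_nonneg.mpr (hw0 x₀).le),
      ← div_eq_inv_mul]
    exact imhAcceptE_ge_of_le hw0 hmax x' y
  ext C hC
  have hD : MeasurableSet {y : Ω | (y, y) ∈ C} := hdiag hC
  have hB : MeasurableSet {y' : Ω | (x₀, y') ∈ C} := measurable_prodMk_left hC
  -- left-hand side: integrate the `u`-sections
  rw [hK (x₀, x'), Measure.map_apply (measurable_crnPairUpdate_apply hw (x₀, x')) hC,
    Measure.prod_apply ((measurable_crnPairUpdate_apply hw (x₀, x')) hC)]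
  have hsec : ∀ y, (volume : Measure unitInterval) (Prod.mk y ⁻¹' ((fun p : Ω × unitInterval =>
      ((if (p.2 : ℝ) * w (x₀, x').1 ≤ w p.1 then p.1 else (x₀, x').1),
        (if (p.2 : ℝ) * w (x₀, x').2 ≤ w p.1 then p.1 else (x₀, x').2))) ⁻¹' C)) =
      {y : Ω | (y, y) ∈ C}.indicator (imhAcceptE w x₀) y +
        ({y' : Ω | (x₀, y') ∈ C}.indicator (fun y' => imhAcceptE w x' y' - imhAcceptE w x₀ y') y +
          {y' : Ω | (x₀, y') ∈ C}.indicator 1 x' * (1 - imhAcceptE w x' y)) := fun y =>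
    volume_section_crnPairUpdate_top hw0 hmax x' y C
  simp_rw [hsec]
  have hfinB : ∫⁻ y in {y' : Ω | (x₀, y') ∈ C}, imhAcceptE w x₀ y ∂q ≠ ⊤ := by
    refine ne_top_of_le_ne_top ENNReal.one_ne_top ?_
    calc ∫⁻ y in {y' : Ω | (x₀, y') ∈ C}, imhAcceptE w x₀ y ∂q ≤ ∫⁻ _ in {y' : Ω | (x₀, y') ∈ C}, 1 ∂q :=
          lintegral_mono fun y => imhAcceptE_le_one w x₀ y
      _ = q {y' : Ω | (x₀, y') ∈ C} := by rw [setLIntegral_const, one_mul]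
      _ ≤ 1 := prob_le_one
  have hfinA : ∫⁻ y, imhAcceptE w x' y ∂q ≠ ⊤ := by
    refine ne_top_of_le_ne_top ENNReal.one_ne_top ?_
    calc ∫⁻ y, imhAcceptE w x' y ∂q ≤ ∫⁻ _, 1 ∂q := lintegral_mono fun y => imhAcceptE_le_one w x' y
      _ = 1 := by rw [lintegral_const, measure_univ, mul_one]
  have hm₁ : Measurable (fun a => {y : Ω | (y, y) ∈ C}.indicator (imhAcceptE w x₀) a) := ha0m.indicator hD
  have hm₂ : Measurable (fun a => {y' : Ω | (x₀, y') ∈ C}.indicator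
      (fun y' => imhAcceptE w x' y' - imhAcceptE w x₀ y') a) := (haxm.sub ha0m).indicator hB
  rw [lintegral_add_left hm₁, lintegral_add_left hm₂,
    lintegral_indicator hD, lintegral_indicator hB, lintegral_const_mul _ (haxm.const_sub 1),
    lintegral_sub ha0m hfinB (ae_of_all _ fun y => ha0_le y),
    lintegral_sub haxm hfinA (ae_of_all _ fun y => imhAcceptE_le_one w x' y), lintegral_const, measure_univ,
    mul_one]
  -- right-hand side: `ε·π(D) = ∫_D a₀`, `(1 − ε)·R(x′, B) = K(x′, B) − ∫_B a₀`
  have hεπ : ∀ {E : Set Ω}, MeasurableSet E → ε * π E = ∫⁻ y in E, imhAcceptE w x₀ y ∂q := by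
    intro E hE
    rw [hπ, withDensity_apply _ hE, ← lintegral_const_mul _ hw.ennreal_ofReal]
    refine lintegral_congr fun y => ?_
    rw [imhAcceptE_mode_eq hw0 hmax y]
  have hRB : (1 - ε) * R x' {y' : Ω | (x₀, y') ∈ C} =
      ∫⁻ y in {y' : Ω | (x₀, y') ∈ C}, imhAcceptE w x' y ∂q +
        (1 - ∫⁻ y, imhAcceptE w x' y ∂q) * {y' : Ω | (x₀, y') ∈ C}.indicator 1 x' -
        ∫⁻ y in {y' : Ω | (x₀, y') ∈ C}, imhAcceptE w x₀ y ∂q := by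
    rw [hR, Doeblin.residualKernel_apply x' hB, ← mul_assoc, ENNReal.mul_inv_cancel h1e h1t, one_mul,
      indepMH_apply hw x' hB, hεπ hB]
    rfl
  have hZX : ∫⁻ y in {y' : Ω | (x₀, y') ∈ C}, imhAcceptE w x₀ y ∂q ≤
      ∫⁻ y in {y' : Ω | (x₀, y') ∈ C}, imhAcceptE w x' y ∂q := lintegral_mono fun y => ha0_le y
  rw [Measure.add_apply, Measure.smul_apply, Measure.smul_apply, smul_eq_mul, smul_eq_mul,
    Measure.map_apply hdiag hC, Measure.map_apply measurable_prodMk_left hC, ← one_sub_ofReal_inv_eq hw0 x₀, ← hε]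
  rw [show (fun y : Ω => (y, y)) ⁻¹' C = {y : Ω | (y, y) ∈ C} from rfl,
    show Prod.mk x₀ ⁻¹' C = {y' : Ω | (x₀, y') ∈ C} from rfl, hεπ hD, hRB,
    mul_comm ({y' : Ω | (x₀, y') ∈ C}.indicator 1 x') (1 - ∫⁻ y, imhAcceptE w x' y ∂q),
    ENNReal.sub_add_eq_add_sub hZX hfinB]

end Summit.Ventures.LatticeQCDFlow.Exactness

end
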